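import Summits.Ventures.PercRepro.RLSRuleKFourGeom

/-!
# C-025 at q = 3: the `K₄`-plane — the supply in abstract witness sums (night-3, gen 4)

* `rho3_eq_of_kFour` — `ρ₃(B′) = C(b, 3) − #{lines inside B′}`;
* `kFour_piece_bound` — the per-subset union bound: a subset with `j` lines inside and `≤ 5` points pays at least
  `ρ₃(T_b − j·L_b)` on its good witnesses, the plane itself `W − 4L_W`;
* **`kFour_supply`** — all four lines charged (`Λ = L`):
  `16T₀ + 12(3T₁ − 3L₁) + 3·4T₁ + 6(8T₂ − 16L₂) + (W − 4L_W) ≤ Σ_{S ∈ Yq} w⁺(G, S)`;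
* **`kFour_supply_free`** — no loss (`Λ = ∅`): `16T₀ + 48T₁ + 48T₂ + W ≤ Σ_{S ∈ Yq} w⁺(G, S)`.
Imports `RLSRuleKFourGeom`.  Axioms: standard.
-/

open scoped Matroid

namespace PercRepro

namespace NightThree

open Finset ThmH PerFlat

variable {α : Type*} [DecidableEq α] {M : Matroid α} [M.Finite]

open scoped Classical in
omit [M.Finite] in
/-- `ρ₃(B′) + #{ℓ ∈ L : ℓ ⊆ B′} = C(|B′|, 3)` on a `K₄`-plane. -/
theorem rho3_eq_of_kFour {G : Finset α} {L : Finset (Finset α)} (h : KFour M G L) {B : Finset α} (hB : B ⊆ G) :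
    rho3 M B + (L.filter (fun ℓ => ℓ ⊆ B)).card = B.card.choose 3 := by
  have hdep := depTriples_eq_of_kFour h
  obtain ⟨hGc, hLc, hL, hdeg, hind⟩ := h
  have hfilt : (B.powersetCard 3).filter (fun (T : Finset α) => ¬ M.Indep (T : Set α)) = L.filter (fun ℓ => ℓ ⊆ B) := by
    ext T
    simp only [Finset.mem_filter, Finset.mem_powersetCard]
    constructor
    · rintro ⟨⟨hTB, hTc⟩, hdep'⟩
      have : T ∈ depTriples M G := by
        unfold depTriples; rw [Finset.mem_filter, Finset.mem_powersetCard]; exact ⟨⟨hTB.trans hB, hTc⟩, hdep'⟩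
      rw [hdep] at this
      exact ⟨this, hTB⟩
    · rintro ⟨hT, hTB⟩
      obtain ⟨_, hTc, hTr⟩ := hL T hT
      exact ⟨⟨hTB, hTc⟩, not_indep_of_eRk_two_card_three hTr hTc⟩
  unfold rho3
  rw [← hfilt, Finset.card_filter_add_card_filter_not, Finset.card_powersetCard]

open scoped Classical in
omit [M.Finite] in
/-- **The per-subset union bound.**  For a subset `B′` with `≤ 5` points and the lines of `L` inside it charged
(a choice `C` of triples, `C ℓ ⊆ K` of size `3`), the good witnesses pay at least `ρ₃(B′)·(T_b − j·L_b)`. -/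
theorem kFour_piece_bound {K : Finset α} (L : Finset (Finset α)) {n N : ℕ}
    (hK : K.card = N + 3) (hn : 2 ≤ n) (C : Finset α → Finset α) (hC : ∀ ℓ ∈ L, C ℓ ⊆ K ∧ (C ℓ).card = 3)
    {B : Finset α} (hB5 : B.card ≤ 5) :
    (rho3 M B : ℚ) * (∑ X ∈ witnessFamily K n, 1 / (((B.card + X.card).choose 3 : ℕ) : ℚ))
      - ((L.filter (fun ℓ => ℓ ⊆ B)).card : ℚ) * ((rho3 M B : ℚ) *
          ∑ j ∈ range (n - 2), (N.choose j : ℚ) * (1 / (((B.card + (j + 3)).choose 3 : ℕ) : ℚ)))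
      ≤ ∑ X ∈ witnessFamily K n, (if ∀ ℓ ∈ L, ℓ ⊆ B → ¬ C ℓ ⊆ X then profileShare M B X else 0) := by
  set Λ' := L.filter (fun ℓ => ℓ ⊆ B) with hΛ'
  have hC' : ∀ ℓ ∈ Λ', C ℓ ⊆ K ∧ (C ℓ).card = 3 := fun ℓ hℓ => hC ℓ (Finset.mem_filter.1 hℓ).1
  set g : ℕ → ℚ := fun x => (rho3 M B : ℚ) / (((B.card + x).choose 3 : ℕ) : ℚ) with hg
  have hb := sum_good_ge_sub hn hK Λ' C hC' g (fun _ => by positivity)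
  have hcond : ∀ X, (∀ ℓ ∈ L, ℓ ⊆ B → ¬ C ℓ ⊆ X) ↔ (∀ ℓ ∈ Λ', ¬ C ℓ ⊆ X) := by
    intro X
    constructor
    · intro hh ℓ hℓ; rw [hΛ', Finset.mem_filter] at hℓ; exact hh ℓ hℓ.1 hℓ.2
    · intro hh ℓ hℓ hℓB; exact hh ℓ (by rw [hΛ', Finset.mem_filter]; exact ⟨hℓ, hℓB⟩)
  have hval : ∀ X ∈ witnessFamily K n, (if ∀ ℓ ∈ L, ℓ ⊆ B → ¬ C ℓ ⊆ X then profileShare M B X else 0) =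
      (if ∀ ℓ ∈ Λ', ¬ C ℓ ⊆ X then g X.card else 0) := by
    intro X _
    by_cases hgd : ∀ ℓ ∈ Λ', ¬ C ℓ ⊆ X
    · rw [if_pos ((hcond X).2 hgd), if_pos hgd]
      unfold profileShare
      rw [if_pos hB5]
    · rw [if_neg (fun hh => hgd ((hcond X).1 hh)), if_neg hgd]
  rw [Finset.sum_congr rfl hval]
  have e1 : ∑ X ∈ witnessFamily K n, g X.card =
      (rho3 M B : ℚ) * ∑ X ∈ witnessFamily K n, 1 / (((B.card + X.card).choose 3 : ℕ) : ℚ) := by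
    rw [Finset.mul_sum]; apply Finset.sum_congr rfl; intro X _; rw [hg]; ring
  have e2 : ∑ j ∈ range (n - 2), (N.choose j : ℚ) * g (j + 3) =
      (rho3 M B : ℚ) * ∑ j ∈ range (n - 2), (N.choose j : ℚ) * (1 / (((B.card + (j + 3)).choose 3 : ℕ) : ℚ)) := by
    rw [Finset.mul_sum]; apply Finset.sum_congr rfl; intro j _; rw [hg]; ring
  rw [e1, e2] at hb
  exact hb

open scoped Classical in
/-- **The profile accounting of the `K₄`-plane, all four lines charged** (`Λ = L`). -/
theorem kFour_supply {p : ℕ} (hc : Core M p) {G K : Finset α} {L : Finset (Finset α)} {n N : ℕ}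
    (hG : G ∈ flatsQ M 3) (h : KFour M G L) (hKsub : K ⊆ gr M \ G) (hKind : M.Indep (K : Set α))
    (hK : K.card = N + 3) (hn : 2 ≤ n) (C : Finset α → Finset α) (hC : ∀ ℓ ∈ L, C ℓ ⊆ K ∧ (C ℓ).card = 3)
    (hgood : ∀ ℓ ∈ L, ∀ X, ¬ C ℓ ⊆ X → GoodWitness M ℓ K X) :
    16 * (∑ X ∈ witnessFamily K n, 1 / (((3 + X.card).choose 3 : ℕ) : ℚ))
    + 12 * (3 * (∑ X ∈ witnessFamily K n, 1 / (((4 + X.card).choose 3 : ℕ) : ℚ))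
        - 3 * ∑ j ∈ range (n - 2), (N.choose j : ℚ) * (1 / (((4 + (j + 3)).choose 3 : ℕ) : ℚ)))
    + 3 * (4 * (∑ X ∈ witnessFamily K n, 1 / (((4 + X.card).choose 3 : ℕ) : ℚ)))
    + 6 * (8 * (∑ X ∈ witnessFamily K n, 1 / (((5 + X.card).choose 3 : ℕ) : ℚ))
        - 16 * ∑ j ∈ range (n - 2), (N.choose j : ℚ) * (1 / (((5 + (j + 3)).choose 3 : ℕ) : ℚ)))
    + (∑ _X ∈ witnessFamily K n, (1 : ℚ) - 4 * ∑ j ∈ range (n - 2), (N.choose j : ℚ) * (1 : ℚ))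
    ≤ ∑ S ∈ Yq M (n + 4) 3, wPlus M G S := by
  obtain ⟨hmem3, h𝔅rank, hd34, hd5, hd6, hc3, hc4, hc5⟩ := kFour_family hc hG h
  have hdep := depTriples_eq_of_kFour h
  have h' := h
  obtain ⟨hGc, hLc, hL, hdeg, hind⟩ := h
  have hsup := supply_ge_profile hc hG hKsub hKind n L (fun ℓ hℓ hnot => by rw [hdep] at hℓ; exact absurd hℓ hnot) C
    hgood h𝔅rank
  refine le_trans ?_ hsup
  set f : Finset α → Finset α → ℚ := fun B X =>
    if ∀ ℓ ∈ L, ℓ ⊆ B → ¬ C ℓ ⊆ X then profileShare M B X else 0 with hf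
  -- the triples: no line inside, `ρ₃ = 1`
  have h3 : 16 * (∑ X ∈ witnessFamily K n, 1 / (((3 + X.card).choose 3 : ℕ) : ℚ)) ≤
      ∑ B ∈ (G.powersetCard 3).filter (fun T => T ∉ L), ∑ X ∈ witnessFamily K n, f B X := by
    have hval : ∀ B ∈ (G.powersetCard 3).filter (fun T => T ∉ L),
        ∑ X ∈ witnessFamily K n, 1 / (((3 + X.card).choose 3 : ℕ) : ℚ) ≤ ∑ X ∈ witnessFamily K n, f B X := by
      intro B hB
      obtain ⟨hBG, hBc, hnl, _⟩ := hmem3 B hB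
      have hb := kFour_piece_bound (M := M) L hK hn C hC (B := B) (by omega)
      have hj : (L.filter (fun ℓ => ℓ ⊆ B)).card = 0 := by
        rw [Finset.card_eq_zero, Finset.filter_eq_empty_iff]; exact hnl
      have hr : rho3 M B = 1 := by
        have := rho3_eq_of_kFour h' hBG
        rw [hj, hBc] at this
        simpa using this
      rw [hj, hr, hBc] at hb
      simpa using hb
    calc 16 * (∑ X ∈ witnessFamily K n, 1 / (((3 + X.card).choose 3 : ℕ) : ℚ))
        = ∑ B ∈ (G.powersetCard 3).filter (fun T => T ∉ L),
            ∑ X ∈ witnessFamily K n, 1 / (((3 + X.card).choose 3 : ℕ) : ℚ) := by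
          rw [Finset.sum_const, hc3, nsmul_eq_mul]; norm_num
      _ ≤ _ := Finset.sum_le_sum hval
  -- the `4`-subsets: `12` lined (`j = 1`, `ρ₃ = 3`), `3` generic
  have h4 : 12 * (3 * (∑ X ∈ witnessFamily K n, 1 / (((4 + X.card).choose 3 : ℕ) : ℚ))
        - 3 * ∑ j ∈ range (n - 2), (N.choose j : ℚ) * (1 / (((4 + (j + 3)).choose 3 : ℕ) : ℚ)))
      + 3 * (4 * (∑ X ∈ witnessFamily K n, 1 / (((4 + X.card).choose 3 : ℕ) : ℚ))) ≤
      ∑ B ∈ G.powersetCard 4, ∑ X ∈ witnessFamily K n, f B X := by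
    set vL : ℚ := 3 * (∑ X ∈ witnessFamily K n, 1 / (((4 + X.card).choose 3 : ℕ) : ℚ))
        - 3 * ∑ j ∈ range (n - 2), (N.choose j : ℚ) * (1 / (((4 + (j + 3)).choose 3 : ℕ) : ℚ)) with hvL
    set vg : ℚ := 4 * (∑ X ∈ witnessFamily K n, 1 / (((4 + X.card).choose 3 : ℕ) : ℚ)) with hvg
    have hval : ∀ B ∈ G.powersetCard 4,
        (if ∃ ℓ ∈ L, ℓ ⊆ B then vL else vg) ≤ ∑ X ∈ witnessFamily K n, f B X := by
      intro B hB
      obtain ⟨hBG, hBc⟩ := Finset.mem_powersetCard.1 hB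
      have hb := kFour_piece_bound (M := M) L hK hn C hC (B := B) (by omega)
      have hj1 := lines_subset_four_kFour hc hG h' hBG hBc
      have hr := rho3_eq_of_kFour h' hBG
      rw [hBc, show Nat.choose 4 3 = 4 by norm_num [Nat.choose]] at hr
      by_cases hex : ∃ ℓ ∈ L, ℓ ⊆ B
      · rw [if_pos hex]
        have hj : (L.filter (fun ℓ => ℓ ⊆ B)).card = 1 := by
          obtain ⟨ℓ, hℓ, hl⟩ := hex
          have : 0 < (L.filter (fun ℓ => ℓ ⊆ B)).card := Finset.card_pos.2 ⟨ℓ, Finset.mem_filter.2 ⟨hℓ, hl⟩⟩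
          omega
        rw [hj] at hr hb
        have hr3 : rho3 M B = 3 := by omega
        rw [hr3, hBc] at hb
        rw [hvL]
        push_cast at hb
        linarith
      · rw [if_neg hex]
        have hj : (L.filter (fun ℓ => ℓ ⊆ B)).card = 0 := by
          rw [Finset.card_eq_zero, Finset.filter_eq_empty_iff]
          intro ℓ hℓ hl; exact hex ⟨ℓ, hℓ, hl⟩
        rw [hj] at hr hb
        have hr4 : rho3 M B = 4 := by omega
        rw [hr4, hBc] at hb
        rw [hvg]
        push_cast at hb
        linarith
    calc 12 * vL + 3 * vg = ∑ B ∈ G.powersetCard 4, (if ∃ ℓ ∈ L, ℓ ⊆ B then vL else vg) := by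
          rw [← Finset.sum_filter_add_sum_filter_not (G.powersetCard 4) (fun B => ∃ ℓ ∈ L, ℓ ⊆ B),
            Finset.sum_congr rfl (fun B hB => if_pos (Finset.mem_filter.1 hB).2),
            Finset.sum_congr rfl (fun B hB => if_neg (Finset.mem_filter.1 hB).2),
            Finset.sum_const, Finset.sum_const, card_lined_four_kFour hc hG h']
          have hrest : ((G.powersetCard 4).filter (fun B => ¬ ∃ ℓ ∈ L, ℓ ⊆ B)).card = 3 := by
            have := Finset.card_filter_add_card_filter_not (s := G.powersetCard 4) (fun B => ∃ ℓ ∈ L, ℓ ⊆ B)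
            rw [card_lined_four_kFour hc hG h', hc4] at this
            omega
          rw [hrest]
          simp only [nsmul_eq_mul]
          push_cast
          ring
      _ ≤ _ := Finset.sum_le_sum hval
  -- the `5`-subsets: `j = 2`, `ρ₃ = 8`
  have h5 : 6 * (8 * (∑ X ∈ witnessFamily K n, 1 / (((5 + X.card).choose 3 : ℕ) : ℚ))
        - 16 * ∑ j ∈ range (n - 2), (N.choose j : ℚ) * (1 / (((5 + (j + 3)).choose 3 : ℕ) : ℚ))) ≤
      ∑ B ∈ G.powersetCard 5, ∑ X ∈ witnessFamily K n, f B X := by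
    have hval : ∀ B ∈ G.powersetCard 5,
        8 * (∑ X ∈ witnessFamily K n, 1 / (((5 + X.card).choose 3 : ℕ) : ℚ))
          - 16 * ∑ j ∈ range (n - 2), (N.choose j : ℚ) * (1 / (((5 + (j + 3)).choose 3 : ℕ) : ℚ)) ≤
        ∑ X ∈ witnessFamily K n, f B X := by
      intro B hB
      obtain ⟨hBG, hBc⟩ := Finset.mem_powersetCard.1 hB
      have hb := kFour_piece_bound (M := M) L hK hn C hC (B := B) (by omega)
      have hj := card_lines_in_five_kFour h' hBG hBc
      have hr := rho3_eq_of_kFour h' hBG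
      rw [hBc, hj, show Nat.choose 5 3 = 10 by norm_num [Nat.choose]] at hr
      have hr8 : rho3 M B = 8 := by omega
      rw [hj, hr8, hBc] at hb
      push_cast at hb
      linarith
    calc _ = ∑ _B ∈ G.powersetCard 5, (8 * (∑ X ∈ witnessFamily K n, 1 / (((5 + X.card).choose 3 : ℕ) : ℚ))
          - 16 * ∑ j ∈ range (n - 2), (N.choose j : ℚ) * (1 / (((5 + (j + 3)).choose 3 : ℕ) : ℚ))) := by
          rw [Finset.sum_const, hc5, nsmul_eq_mul]; norm_num
      _ ≤ _ := Finset.sum_le_sum hval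
  -- the plane itself: all four lines charged, the winner share
  have h6 : ∑ _X ∈ witnessFamily K n, (1 : ℚ) - 4 * ∑ j ∈ range (n - 2), (N.choose j : ℚ) * (1 : ℚ) ≤
      ∑ X ∈ witnessFamily K n, f G X := by
    have hb := sum_good_ge_sub hn hK L C hC (fun _ => (1 : ℚ)) (fun _ => by positivity)
    rw [hLc] at hb
    push_cast at hb
    have hval : ∀ X ∈ witnessFamily K n, f G X = (if ∀ ℓ ∈ L, ¬ C ℓ ⊆ X then (fun _ => (1 : ℚ)) X.card else 0) := by
      intro X _
      rw [hf]
      dsimp only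
      have : (∀ ℓ ∈ L, ℓ ⊆ G → ¬ C ℓ ⊆ X) ↔ (∀ ℓ ∈ L, ¬ C ℓ ⊆ X) :=
        ⟨fun hh ℓ hℓ => hh ℓ hℓ (hL ℓ hℓ).1, fun hh ℓ hℓ _ => hh ℓ hℓ⟩
      by_cases hgd : ∀ ℓ ∈ L, ¬ C ℓ ⊆ X
      · rw [if_pos (this.2 hgd), if_pos hgd]; unfold profileShare; rw [if_neg (by omega)]
      · rw [if_neg (fun hh => hgd (this.1 hh)), if_neg hgd]
    rw [Finset.sum_congr rfl hval]
    exact hb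
  rw [Finset.sum_union hd6, Finset.sum_union hd5, Finset.sum_union hd34, Finset.sum_singleton]
  linarith

open scoped Classical in
/-- **The profile accounting of the `K₄`-plane, no loss** (`Λ = ∅`). -/
theorem kFour_supply_free {p : ℕ} (hc : Core M p) {G K : Finset α} {L : Finset (Finset α)} {n : ℕ}
    (hG : G ∈ flatsQ M 3) (h : KFour M G L) (hKsub : K ⊆ gr M \ G) (hKind : M.Indep (K : Set α))
    (hemp : ∀ ℓ ∈ L, coplanarTriples M ℓ K = ∅) :
    16 * (∑ X ∈ witnessFamily K n, 1 / (((3 + X.card).choose 3 : ℕ) : ℚ))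
    + 48 * (∑ X ∈ witnessFamily K n, 1 / (((4 + X.card).choose 3 : ℕ) : ℚ))
    + 48 * (∑ X ∈ witnessFamily K n, 1 / (((5 + X.card).choose 3 : ℕ) : ℚ))
    + (∑ _X ∈ witnessFamily K n, (1 : ℚ))
    ≤ ∑ S ∈ Yq M (n + 4) 3, wPlus M G S := by
  obtain ⟨hmem3, h𝔅rank, hd34, hd5, hd6, hc3, hc4, hc5⟩ := kFour_family hc hG h
  have hdep := depTriples_eq_of_kFour h
  have h' := h
  obtain ⟨hGc, hLc, hL, hdeg, hind⟩ := h
  have hsup := supply_ge_profile hc hG hKsub hKind n (∅ : Finset (Finset α))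
    (fun ℓ hℓ _ => by rw [hdep] at hℓ; exact hemp ℓ hℓ) (fun _ => ∅)
    (fun ℓ hℓ => absurd hℓ (Finset.notMem_empty ℓ)) h𝔅rank
  refine le_trans ?_ hsup
  have hval : ∀ B X, (if ∀ ℓ ∈ (∅ : Finset (Finset α)), ℓ ⊆ B → ¬ (fun _ => (∅ : Finset α)) ℓ ⊆ X then
      profileShare M B X else 0) = profileShare M B X := by
    intro B X
    rw [if_pos (fun ℓ hℓ => absurd hℓ (Finset.notMem_empty ℓ))]
  simp only [hval]
  -- `profileShare = ρ₃/C(b+x,3)` with `ρ₃ = C(b,3) − j`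
  have hshare : ∀ B, B ⊆ G → 3 ≤ B.card → B.card ≤ 5 → ∀ X,
      profileShare M B X = ((B.card.choose 3 - (L.filter (fun ℓ => ℓ ⊆ B)).card : ℕ) : ℚ) /
        (((B.card + X.card).choose 3 : ℕ) : ℚ) := by
    intro B hB _ hB5 X
    unfold profileShare
    rw [if_pos hB5]
    congr 1
    have := rho3_eq_of_kFour h' hB
    exact_mod_cast (by omega : rho3 M B = B.card.choose 3 - (L.filter (fun ℓ => ℓ ⊆ B)).card)
  have h3 : ∑ B ∈ (G.powersetCard 3).filter (fun T => T ∉ L), ∑ X ∈ witnessFamily K n, profileShare M B X =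
      16 * (∑ X ∈ witnessFamily K n, 1 / (((3 + X.card).choose 3 : ℕ) : ℚ)) := by
    have hv : ∀ B ∈ (G.powersetCard 3).filter (fun T => T ∉ L), ∑ X ∈ witnessFamily K n, profileShare M B X =
        ∑ X ∈ witnessFamily K n, 1 / (((3 + X.card).choose 3 : ℕ) : ℚ) := by
      intro B hB
      obtain ⟨hBG, hBc, hnl, _⟩ := hmem3 B hB
      have hj : (L.filter (fun ℓ => ℓ ⊆ B)).card = 0 := by
        rw [Finset.card_eq_zero, Finset.filter_eq_empty_iff]; exact hnl
      apply Finset.sum_congr rfl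
      intro X _
      rw [hshare B hBG (by omega) (by omega) X, hj, hBc]
      simp
    rw [Finset.sum_congr rfl hv, Finset.sum_const, hc3, nsmul_eq_mul]; norm_num
  have h4 : ∑ B ∈ G.powersetCard 4, ∑ X ∈ witnessFamily K n, profileShare M B X =
      12 * (3 * ∑ X ∈ witnessFamily K n, 1 / (((4 + X.card).choose 3 : ℕ) : ℚ))
      + 3 * (4 * ∑ X ∈ witnessFamily K n, 1 / (((4 + X.card).choose 3 : ℕ) : ℚ)) := by
    have hv : ∀ B ∈ G.powersetCard 4, ∑ X ∈ witnessFamily K n, profileShare M B X =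
        (if ∃ ℓ ∈ L, ℓ ⊆ B then 3 * ∑ X ∈ witnessFamily K n, 1 / (((4 + X.card).choose 3 : ℕ) : ℚ)
          else 4 * ∑ X ∈ witnessFamily K n, 1 / (((4 + X.card).choose 3 : ℕ) : ℚ)) := by
      intro B hB
      obtain ⟨hBG, hBc⟩ := Finset.mem_powersetCard.1 hB
      have hj1 := lines_subset_four_kFour hc hG h' hBG hBc
      by_cases hex : ∃ ℓ ∈ L, ℓ ⊆ B
      · rw [if_pos hex]
        have hj : (L.filter (fun ℓ => ℓ ⊆ B)).card = 1 := by
          obtain ⟨ℓ, hℓ, hl⟩ := hex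
          have : 0 < (L.filter (fun ℓ => ℓ ⊆ B)).card := Finset.card_pos.2 ⟨ℓ, Finset.mem_filter.2 ⟨hℓ, hl⟩⟩
          omega
        rw [Finset.mul_sum]; apply Finset.sum_congr rfl; intro X _
        rw [hshare B hBG (by omega) (by omega) X, hj, hBc, show Nat.choose 4 3 = 4 by norm_num [Nat.choose]]
        norm_num [div_eq_mul_inv]
      · rw [if_neg hex]
        have hj : (L.filter (fun ℓ => ℓ ⊆ B)).card = 0 := by
          rw [Finset.card_eq_zero, Finset.filter_eq_empty_iff]
          intro ℓ hℓ hl; exact hex ⟨ℓ, hℓ, hl⟩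
        rw [Finset.mul_sum]; apply Finset.sum_congr rfl; intro X _
        rw [hshare B hBG (by omega) (by omega) X, hj, hBc, show Nat.choose 4 3 = 4 by norm_num [Nat.choose]]
        norm_num [div_eq_mul_inv]
    rw [Finset.sum_congr rfl hv, ← Finset.sum_filter_add_sum_filter_not (G.powersetCard 4) (fun B => ∃ ℓ ∈ L, ℓ ⊆ B),
      Finset.sum_congr rfl (fun B hB => if_pos (Finset.mem_filter.1 hB).2),
      Finset.sum_congr rfl (fun B hB => if_neg (Finset.mem_filter.1 hB).2),
      Finset.sum_const, Finset.sum_const, card_lined_four_kFour hc hG h']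
    have hrest : ((G.powersetCard 4).filter (fun B => ¬ ∃ ℓ ∈ L, ℓ ⊆ B)).card = 3 := by
      have := Finset.card_filter_add_card_filter_not (s := G.powersetCard 4) (fun B => ∃ ℓ ∈ L, ℓ ⊆ B)
      rw [card_lined_four_kFour hc hG h', hc4] at this
      omega
    rw [hrest]
    simp only [nsmul_eq_mul]
    push_cast
    ring
  have h5 : ∑ B ∈ G.powersetCard 5, ∑ X ∈ witnessFamily K n, profileShare M B X =
      6 * (8 * ∑ X ∈ witnessFamily K n, 1 / (((5 + X.card).choose 3 : ℕ) : ℚ)) := by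
    have hv : ∀ B ∈ G.powersetCard 5, ∑ X ∈ witnessFamily K n, profileShare M B X =
        8 * ∑ X ∈ witnessFamily K n, 1 / (((5 + X.card).choose 3 : ℕ) : ℚ) := by
      intro B hB
      obtain ⟨hBG, hBc⟩ := Finset.mem_powersetCard.1 hB
      have hj := card_lines_in_five_kFour h' hBG hBc
      rw [Finset.mul_sum]; apply Finset.sum_congr rfl; intro X _
      rw [hshare B hBG (by omega) (by omega) X, hj, hBc, show Nat.choose 5 3 = 10 by norm_num [Nat.choose]]
      norm_num [div_eq_mul_inv]
    rw [Finset.sum_congr rfl hv, Finset.sum_const, hc5, nsmul_eq_mul]; norm_num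
  have h6 : ∑ X ∈ witnessFamily K n, profileShare M G X = ∑ _X ∈ witnessFamily K n, (1 : ℚ) := by
    apply Finset.sum_congr rfl; intro X _; unfold profileShare; rw [if_neg (by omega)]
  rw [Finset.sum_union hd6, Finset.sum_union hd5, Finset.sum_union hd34, Finset.sum_singleton, h3, h4, h5, h6]
  linarith

end NightThree

end PercRepro
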